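import Literature.MathematicalPhysics.QuantumLattice.SectorPartitionFnCut
import HarnessLib

/-!
# The finite-temperature cut, summed over the particle-number splittings: the canonical partition
# function dominates the CONVOLUTION of the block canonical partition functions

Family `hubbard` (topic `MathematicalPhysics/QuantumLattice`). `SectorPartitionFnCut.lean` proves, for a
two-graph Hubbard Hamiltonian `H_{G,G'}` on the ordered disjoint union `Λ = Λ₁ ⊔ Λ₂` and ONE splitting
`(a₁,b₁) + (a₂,b₂)` of the particle numbers, `e^{-β pen} Re Z₁(a₁,b₁) · Re Z₂(a₂,b₂) ≤ Re Z(a₁+a₂, b₁+b₂)`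
(Peierls' inequality for the product family of the two sector eigenbases). Product families belonging to
DIFFERENT splittings are mutually orthogonal (they live in different local particle-number sectors), so
the union over all splittings is still an orthonormal family of the big sector, and Peierls' inequality
gives the SUM:

* `dotProduct_eq_zero_of_isInSector_ne` — vectors in different spin sectors are orthogonal;
* `partitionFn_twoGraph_sector_cut_sum` — for `β ≥ 0` and any finite set `T` of splittings
  `(a₂,b₂) ≤ (A,B)`:
  `e^{-β(2|t|(k₁+k₂) + 2|t'|(k₁'+k₂'))} · Σ_{(a₂,b₂) ∈ T} Re Z₁(A−a₂, B−b₂) · Re Z₂(a₂, b₂) ≤ Re Z(A, B)`;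
* `partitionFn_twoGraph_sector_cut_sum_of_induced` — induced block bond sets (open clusters): no penalty,
  `Σ_{(a₂,b₂) ∈ T} Re Z₁(A−a₂,B−b₂) · Re Z₂(a₂,b₂) ≤ Re Z(A,B)` — the canonical partition function dominates
  the convolution of the cluster canonical partition functions. This is the finite-volume core of the
  "type-class product trial state" free-energy bound (uniform mixtures over assignments of cluster states
  with prescribed particle numbers carry the mixing ENTROPY `log #assignments`), the certificate C2 of the
  `hubbard-thermal` free-energy programme.

[cite: Ruelle1969, §3.3] (sub-box estimates, Peierls §2.5); [cite: Israel1979, Lemma II.3.1] (Gibbs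
variational principle). Everything is PROVED; no definition, no named fact.
-/

noncomputable section

namespace Literature.MathematicalPhysics.QuantumLattice

open Matrix Finset HubbardWave0 ThermodynamicLimit LiebThm1
open scoped ComplexOrder BigOperators

namespace ThermodynamicLimit

/-! ### §1 Different spin sectors are orthogonal -/

section Orthogonal

variable {Λ : Type*} [LinearOrder Λ] [Fintype Λ]

/-- **Vectors in different spin sectors are orthogonal**: if `u` lies in the sector `(a, b)` and `v` in
`(a', b')` with `(a, b) ≠ (a', b')`, then `⟨u, v⟩ = 0` (their supports are disjoint sets of occupation
configurations). [cite: LiebPRL1989, proof of Theorem 1] -/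
theorem dotProduct_eq_zero_of_isInSector_ne {a b a' b' : ℕ} {u v : Fock (Orb Λ)} (hu : IsInSector a b u)
    (hv : IsInSector a' b' v) (hne : (a, b) ≠ (a', b')) : star u ⬝ᵥ v = 0 := by
  rw [dotProduct]
  refine Finset.sum_eq_zero fun s _ => ?_
  by_cases hs : spinConfig a b s
  · have hs' : ¬ spinConfig a' b' s := by
      rintro ⟨h1, h2⟩
      exact hne (by rw [← hs.1, ← hs.2, h1, h2])
    rw [(isInSector_iff_support a' b' v).1 hv s hs', mul_zero]
  · rw [Pi.star_apply, (isInSector_iff_support a b u).1 hu s hs, star_zero, zero_mul]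

end Orthogonal

/-! ### §2 The cut, summed over splittings -/

section TwoGraphCutSum

variable {Λ₁ Λ₂ Λ : Type*} [LinearOrder Λ₁] [Fintype Λ₁] [LinearOrder Λ₂] [Fintype Λ₂]
  [LinearOrder Λ] [Fintype Λ]

/-- **The finite-temperature cut, summed over the particle-number splittings.** In the setting of
`partitionFn_twoGraph_sector_cut` (two bond sets `G, G'` on `Λ = Λ₁ ⊔ Λ₂`, block bond sets with at most
`k_i, k_i'` discrepant ordered pairs), for `β ≥ 0`, target particle numbers `(A, B)` and any finite set `T`
of splittings `(a₂, b₂)` with `a₂ ≤ A`, `b₂ ≤ B` (the upper block's share):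
`e^{-β(2|t|(k₁+k₂) + 2|t'|(k₁'+k₂'))} · Σ_{(a₂,b₂) ∈ T} Re Z_β(H₁; A−a₂, B−b₂) · Re Z_β(H₂; a₂, b₂)
  ≤ Re Z_β(H; A, B)`.
Proof: Peierls' inequality for the union over `T` of the product families of the sector eigenbases —
orthonormal because products belonging to different splittings lie in different local sectors.
[cite: Ruelle1969, §3.3] [cite: Israel1979, Lemma II.3.1] -/
theorem partitionFn_twoGraph_sector_cut_sum (G₁ G₁' : SimpleGraph Λ₁) (G₂ G₂' : SimpleGraph Λ₂)
    (G G' : SimpleGraph Λ) [DecidableRel G₁.Adj] [DecidableRel G₁'.Adj] [DecidableRel G₂.Adj]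
    [DecidableRel G₂'.Adj] [DecidableRel G.Adj] [DecidableRel G'.Adj]
    {e₁ : Λ₁ → Λ} {e₂ : Λ₂ → Λ} (he₁ : StrictMono e₁) (he₂ : StrictMono e₂)
    (h12 : ∀ x y, e₁ x < e₂ y) (hcov : ∀ z, (∃ x, e₁ x = z) ∨ ∃ y, e₂ y = z)
    {k₁ k₂ k₁' k₂' : ℕ} (hk₁ : #{p : Λ₁ × Λ₁ | ¬ (G.Adj (e₁ p.1) (e₁ p.2) ↔ G₁.Adj p.1 p.2)} ≤ k₁)
    (hk₂ : #{p : Λ₂ × Λ₂ | ¬ (G.Adj (e₂ p.1) (e₂ p.2) ↔ G₂.Adj p.1 p.2)} ≤ k₂)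
    (hk₁' : #{p : Λ₁ × Λ₁ | ¬ (G'.Adj (e₁ p.1) (e₁ p.2) ↔ G₁'.Adj p.1 p.2)} ≤ k₁')
    (hk₂' : #{p : Λ₂ × Λ₂ | ¬ (G'.Adj (e₂ p.1) (e₂ p.2) ↔ G₂'.Adj p.1 p.2)} ≤ k₂')
    (t U t' U' : ℝ) {β : ℝ} (hβ : 0 ≤ β) (A B : ℕ) (T : Finset (ℕ × ℕ))
    (hT : ∀ q ∈ T, q.1 ≤ A ∧ q.2 ≤ B) :
    Real.exp (-(β * (2 * |t| * (k₁ + k₂) + 2 * |t'| * (k₁' + k₂')))) *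
        ∑ q ∈ T, (partitionFn β (spinSectorHamiltonian (A - q.1) (B - q.2)
            (hamiltonian G₁ t U + hamiltonian G₁' t' U'))).re *
          (partitionFn β (spinSectorHamiltonian q.1 q.2 (hamiltonian G₂ t U + hamiltonian G₂' t' U'))).re ≤
      (partitionFn β (spinSectorHamiltonian A B (hamiltonian G t U + hamiltonian G' t' U'))).re := by
  classical
  -- the three Hamiltonians
  set H₁ := hamiltonian G₁ t U + hamiltonian G₁' t' U' with hH₁def
  set H₂ := hamiltonian G₂ t U + hamiltonian G₂' t' U' with hH₂def
  set H := hamiltonian G t U + hamiltonian G' t' U' with hHdef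
  have hH₁ : H₁.IsHermitian := (hamiltonian_isHermitian G₁ t U).add (hamiltonian_isHermitian G₁' t' U')
  have hH₂ : H₂.IsHermitian := (hamiltonian_isHermitian G₂ t U).add (hamiltonian_isHermitian G₂' t' U')
  have hH : H.IsHermitian := (hamiltonian_isHermitian G t U).add (hamiltonian_isHermitian G' t' U')
  have hP₁ : PreservesSectors H₁ :=
    (preservesSectors_hamiltonian G₁ t U).add (preservesSectors_hamiltonian G₁' t' U')
  have hP₂ : PreservesSectors H₂ :=
    (preservesSectors_hamiltonian G₂ t U).add (preservesSectors_hamiltonian G₂' t' U')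
  -- orbital maps
  have hO₁m : StrictMono (fun p : Orb Λ₁ => orb (e₁ (ofLex p).1) (ofLex p).2) := strictMono_orbMap he₁
  have hO₂m : StrictMono (fun q : Orb Λ₂ => orb (e₂ (ofLex q).1) (ofLex q).2) := strictMono_orbMap he₂
  have hO12 : ∀ (p : Orb Λ₁) (q : Orb Λ₂),
      orb (e₁ (ofLex p).1) (ofLex p).2 < orb (e₂ (ofLex q).1) (ofLex q).2 := orbMap_lt_orbMap h12
  have hOcov := orbMap_cover (e₁ := e₁) (e₂ := e₂) hcov
  have hOne : ∀ (p : Orb Λ₁) (q : Orb Λ₂),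
      orb (e₁ (ofLex p).1) (ofLex p).2 ≠ orb (e₂ (ofLex q).1) (ofLex q).2 := fun p q => (hO12 p q).ne
  have hene : ∀ x y, e₁ x ≠ e₂ y := fun x y => (h12 x y).ne
  -- the sector eigenbases, one pair per splitting `q ∈ T`
  set p : Finset (Orb Λ) → Prop := spinConfig (Λ := Λ) A B with hp
  let p₁ : ↥T → Finset (Orb Λ₁) → Prop := fun q => spinConfig (Λ := Λ₁) (A - q.1.1) (B - q.1.2)
  let p₂ : ↥T → Finset (Orb Λ₂) → Prop := fun q => spinConfig (Λ := Λ₂) q.1.1 q.1.2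
  let φ₁ : (q : ↥T) → Subtype (p₁ q) → Fock (Orb Λ₁) := fun q => sectorEigenvector (p₁ q) H₁ hH₁
  let φ₂ : (q : ↥T) → Subtype (p₂ q) → Fock (Orb Λ₂) := fun q => sectorEigenvector (p₂ q) H₂ hH₂
  let lam₁ : (q : ↥T) → Subtype (p₁ q) → ℝ := fun q => sectorEigenvalue (p₁ q) H₁ hH₁
  let lam₂ : (q : ↥T) → Subtype (p₂ q) → ℝ := fun q => sectorEigenvalue (p₂ q) H₂ hH₂
  have hinv₁ : ∀ q s s', ¬ p₁ q s → p₁ q s' → H₁ s s' = 0 :=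
    fun q s s' hs hs' => apply_eq_zero_of_preservesSectors hP₁ _ _ s s' hs hs'
  have hinv₂ : ∀ q s s', ¬ p₂ q s → p₂ q s' → H₂ s s' = 0 :=
    fun q s s' hs hs' => apply_eq_zero_of_preservesSectors hP₂ _ _ s s' hs hs'
  have hφ₁on : ∀ q c c', star (φ₁ q c) ⬝ᵥ φ₁ q c' = if c = c' then 1 else 0 :=
    fun q c c' => star_sectorEigenvector_dotProduct (p₁ q) H₁ hH₁ c c'
  have hφ₂on : ∀ q d d', star (φ₂ q d) ⬝ᵥ φ₂ q d' = if d = d' then 1 else 0 :=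
    fun q d d' => star_sectorEigenvector_dotProduct (p₂ q) H₂ hH₂ d d'
  have hφ₁sec : ∀ q c, IsInSector (A - q.1.1) (B - q.1.2) (φ₁ q c) :=
    fun q c s hs => sectorEigenvector_apply_of_not_mem (p₁ q) H₁ hH₁ c hs
  have hφ₂sec : ∀ q d, IsInSector q.1.1 q.1.2 (φ₂ q d) :=
    fun q d s hs => sectorEigenvector_apply_of_not_mem (p₂ q) H₂ hH₂ d hs
  have hφ₁E : ∀ q c, (star (φ₁ q c) ⬝ᵥ (H₁ *ᵥ φ₁ q c)).re = lam₁ q c :=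
    fun q c => re_rayleigh_sectorEigenvector (p₁ q) hH₁ (hinv₁ q) c
  have hφ₂E : ∀ q d, (star (φ₂ q d) ⬝ᵥ (H₂ *ᵥ φ₂ q d)).re = lam₂ q d :=
    fun q d => re_rayleigh_sectorEigenvector (p₂ q) hH₂ (hinv₂ q) d
  -- the union over splittings of the product families
  let Ψ : (Σ q : ↥T, Subtype (p₁ q) × Subtype (p₂ q)) → Fock (Orb Λ) := fun I s =>
    φ₁ I.1 I.2.1 {r : Orb Λ₁ | orb (e₁ (ofLex r).1) (ofLex r).2 ∈ s} *
      φ₂ I.1 I.2.2 {r : Orb Λ₂ | orb (e₂ (ofLex r).1) (ofLex r).2 ∈ s}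
  have hΨon : ∀ I J, star (Ψ I) ⬝ᵥ Ψ J = if I = J then 1 else 0 := by
    rintro ⟨q, c, d⟩ ⟨q', c', d'⟩
    simp only [Ψ]
    rw [dotProduct_prodVec hO₁m.injective hO₂m.injective hOne hOcov]
    by_cases hq : q = q'
    · subst hq
      rw [hφ₁on, hφ₂on]
      by_cases hc : c = c'
      · by_cases hd : d = d'
        · subst hc; subst hd; simp
        · simp [hd]
      · simp [hc]
    · have hne : (q.1.1, q.1.2) ≠ (q'.1.1, q'.1.2) := by
        intro h
        apply hq
        exact Subtype.ext (Prod.ext (Prod.mk.inj h).1 (Prod.mk.inj h).2)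
      rw [dotProduct_eq_zero_of_isInSector_ne (hφ₂sec q d) (hφ₂sec q' d') hne, mul_zero]
      have hIJ : (⟨q, c, d⟩ : Σ q : ↥T, Subtype (p₁ q) × Subtype (p₂ q)) ≠ ⟨q', c', d'⟩ := by
        intro h
        exact hq (congrArg Sigma.fst h)
      rw [if_neg hIJ]
  have hΨsupp : ∀ I s, ¬ p s → Ψ I s = 0 := by
    rintro ⟨q, c, d⟩ s hs
    have h1 := isInSector_blockProd he₁.injective he₂.injective hene hcov (hφ₁sec q c) (hφ₂sec q d)
    rw [Nat.sub_add_cancel (hT q.1 q.2).1, Nat.sub_add_cancel (hT q.1 q.2).2] at h1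
    exact h1 s hs
  -- Rayleigh quotients of the product vectors
  set pen : ℝ := 2 * |t| * (k₁ + k₂) + 2 * |t'| * (k₁' + k₂') with hpen
  have hΨE : ∀ I, (star (Ψ I) ⬝ᵥ (H *ᵥ Ψ I)).re ≤ lam₁ I.1 I.2.1 + lam₂ I.1 I.2.2 + pen := by
    rintro ⟨q, c, d⟩
    have hN : IsNParticle ((A - q.1.1) + (B - q.1.2)) (φ₁ q c) := (hφ₁sec q c).isNParticle
    have hu₁ : star (φ₁ q c) ⬝ᵥ φ₁ q c = 1 := by rw [hφ₁on, if_pos rfl]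
    have hu₂ : star (φ₂ q d) ⬝ᵥ φ₂ q d = 1 := by rw [hφ₂on, if_pos rfl]
    have h1 := re_dotProduct_hamiltonian_blockProd_le G₁ G₂ G he₁ he₂ h12 hcov hk₁ hk₂ t U hN hu₁ hu₂
    have h2 := re_dotProduct_hamiltonian_blockProd_le G₁' G₂' G' he₁ he₂ h12 hcov hk₁' hk₂' t' U' hN
      hu₁ hu₂
    have hsum₁ := hφ₁E q c
    have hsum₂ := hφ₂E q d
    rw [hH₁def, add_mulVec, dotProduct_add, Complex.add_re] at hsum₁
    rw [hH₂def, add_mulVec, dotProduct_add, Complex.add_re] at hsum₂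
    simp only [Ψ]
    rw [hHdef, add_mulVec, dotProduct_add, Complex.add_re, hpen]
    linarith
  -- Peierls' inequality for the family, compressed to the sector `p`
  have hPe := hH.sum_exp_neg_mul_rayleigh_le_partitionFn_submatrix p β hΨon hΨsupp
  refine le_trans ?_ hPe
  have hmono : ∑ I : (Σ q : ↥T, Subtype (p₁ q) × Subtype (p₂ q)),
      Real.exp (-(β * (lam₁ I.1 I.2.1 + lam₂ I.1 I.2.2 + pen))) ≤
      ∑ I, Real.exp (-(β * (star (Ψ I) ⬝ᵥ (H *ᵥ Ψ I)).re)) := by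
    refine sum_le_sum fun I _ => Real.exp_le_exp.mpr ?_
    have := hΨE I
    nlinarith
  refine le_trans (le_of_eq ?_) hmono
  -- the left-hand side, splitting by splitting
  rw [Fintype.sum_sigma, Finset.mul_sum, ← Finset.sum_coe_sort T]
  refine sum_congr rfl fun q _ => ?_
  rw [partitionFn_spinSectorHamiltonian_re _ _ hH₁, partitionFn_spinSectorHamiltonian_re _ _ hH₂,
    Fintype.sum_prod_type, Finset.sum_mul_sum, Finset.mul_sum]
  refine sum_congr rfl fun c _ => ?_
  rw [Finset.mul_sum]
  refine sum_congr rfl fun d _ => ?_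
  dsimp only [lam₁, lam₂]
  rw [← Real.exp_add, ← Real.exp_add]
  congr 1
  ring

omit [LinearOrder Λ₁] [LinearOrder Λ] [Fintype Λ] in
/-- An induced bond set has no discrepant pairs. [cite: Ruelle1969, §3.3] -/
private theorem card_discrepancy_comap_le_zero' (K : SimpleGraph Λ) [DecidableRel K.Adj] (f : Λ₁ ↪ Λ) :
    #{q : Λ₁ × Λ₁ | ¬ (K.Adj (f q.1) (f q.2) ↔ (K.comap f).Adj q.1 q.2)} ≤ 0 := by
  rw [Nat.le_zero, Finset.card_eq_zero, Finset.filter_eq_empty_iff]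
  intro q _
  simp [SimpleGraph.comap_adj]

/-- **Induced blocks: the canonical partition function dominates the convolution of the cluster canonical
partition functions.** If the block bond sets are the restrictions of `G, G'` along the embeddings (open
clusters), then for `β ≥ 0`, target `(A, B)` and any finite set `T` of splittings `(a₂, b₂) ≤ (A, B)`:
`Σ_{(a₂,b₂) ∈ T} Re Z_β(H₁|_{(A−a₂,B−b₂)}) · Re Z_β(H₂|_{(a₂,b₂)}) ≤ Re Z_β(H|_{(A,B)})` — the uniform
mixture over the splittings (and over the cluster eigenstates) is a trial state of the sector `(A,B)`
whose free energy carries the mixing entropy. [cite: Ruelle1969, §3.3] [cite: Israel1979, Lemma II.3.1] -/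
theorem partitionFn_twoGraph_sector_cut_sum_of_induced (G G' : SimpleGraph Λ) [DecidableRel G.Adj]
    [DecidableRel G'.Adj] {e₁ : Λ₁ ↪ Λ} {e₂ : Λ₂ ↪ Λ} (he₁ : StrictMono e₁) (he₂ : StrictMono e₂)
    (h12 : ∀ x y, e₁ x < e₂ y) (hcov : ∀ z, (∃ x, e₁ x = z) ∨ ∃ y, e₂ y = z) (t U t' U' : ℝ)
    {β : ℝ} (hβ : 0 ≤ β) (A B : ℕ) (T : Finset (ℕ × ℕ)) (hT : ∀ q ∈ T, q.1 ≤ A ∧ q.2 ≤ B) :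
    ∑ q ∈ T, (partitionFn β (spinSectorHamiltonian (A - q.1) (B - q.2)
        (hamiltonian (G.comap e₁) t U + hamiltonian (G'.comap e₁) t' U'))).re *
      (partitionFn β (spinSectorHamiltonian q.1 q.2
        (hamiltonian (G.comap e₂) t U + hamiltonian (G'.comap e₂) t' U'))).re ≤
      (partitionFn β (spinSectorHamiltonian A B (hamiltonian G t U + hamiltonian G' t' U'))).re := by
  have h := partitionFn_twoGraph_sector_cut_sum (G.comap e₁) (G'.comap e₁) (G.comap e₂) (G'.comap e₂) G G'
    he₁ he₂ h12 hcov (card_discrepancy_comap_le_zero' G e₁) (card_discrepancy_comap_le_zero' G e₂)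
    (card_discrepancy_comap_le_zero' G' e₁) (card_discrepancy_comap_le_zero' G' e₂) t U t' U' hβ A B T hT
  simpa using h

end TwoGraphCutSum

end ThermodynamicLimit

end Literature.MathematicalPhysics.QuantumLattice

end
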